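import Summits.CriticalPhenomena.PercolationContinuityZ3.Theorems.Transplant.SkelFrmBParamsFaceCountsRangeA
import Summits.CriticalPhenomena.PercolationContinuityZ3.Theorems.Transplant.SkelFrmBParamsFaceLamA
import Summits.CriticalPhenomena.PercolationContinuityZ3.Theorems.Transplant.SkelFrmBChoiceWindow
import Summits.CriticalPhenomena.PercolationContinuityZ3.Theorems.Transplant.PlanarSkeletonFrmDefs
import Summits.CriticalPhenomena.PercolationContinuityZ3.Theorems.Transplant.SkelPhiStepIDataNS
import HarnessLib
/-!
(F) VALUE LAYER, N2 twin (hp-8 g42, 2026-08-23; F-DISCHARGE-MAP-N2 G18 zone floors, (Δ1)/(R-22)/E6): N1 `SkelNegBParamsFaceFloorsZXA` (p1-g14) over a generic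
staggered cell family `(P : PCells2T) (hP : P.toPCells2 = fcellsA …)`, `SkelFrmBParamsFaceLamA` (kF₀A/kF₁A at the wide pair), `…FaceCountsRangeA` (faceL_bounds) and the
window of record: `hfR_XA` now serves the CREEP-AWARE transverse habitat `kF₁A ≤ 5r₁ − 7 − c 0 − |z 1 − cenS x 1|` from the creep-aware served hypothesis
`hkE8 : kE + 8·u₁A + 8 + c 0 ≤ 5·r₁` (N1: no `c 0`; the assembly discharges it from a `4·r₁` band + `c 0 ≤ r 1`), and `hZfar_XA` reads `BSlot.small 0 = 30·s₀`
instead of `b0TA 0 = 10·Kq·u₀` (ample: `39u₀ + 1 < 200·Kq·u₀`); kit radius `RA′ ↦ KS0.R'0` in `hs0`. Proofs otherwise verbatim.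
NON-VACUITY: integer arithmetic under the provider's level/offset hypotheses and four served floors.
builds on p205010 (kernel theorem, internal audit signed; external expert review pending); nothing here is a claim about the open node `SamePDropOfSkeletonFrm₁`.
N1 HEADER (kept for the reader):
# N1 params, M3 group G-Z (x-face) — **THE HABITAT-VERSUS-ZONE FLOORS OF AN x-FACE AT THE (ζ′) TUPLE**: the fields `hfR` and `hZfar` of
# `Skelφ.FloorsX2` (SkelPhiFaceNumsXP2 :43–:45) at M3-FLOORS-SIGNATURE §1 with the Λ-ceilings `kA 0 := kF₀A`, `kA 1 := kF₁A` (FaceLamA p320758)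
(p1-g14, 2026-08-22; claim lane INBOX 07:57:35Z; conclusions = p3-g12's pinned `hfR_XA`/`hZfar_XA` with the skeleton's `kAF κ Φ t p D c mk g f` — a `def`
not yet in the tree — written as its literal `fun i => if i = 0 then kF₀A … else kF₁A …` (definitionally equal; the assembly's `⟨…⟩` elaborates through it)).
Slot-generic in `(g, f)`; premise block trimmed; FOUR added hypotheses in served shapes: `hkF0 : kF₀A ≤ 8·u₀A + 1`, `hkF1 : kF₁A ≤ 8·u₁A + 1`
(= `KS.kFA_le` at `g := gT mk gx` under `16·S_F ≤ M_L`), `hs0 : 6·RA′ + 11 ≤ u₀A` (= `(KS.cells_geTA' …).1`), `hkE8 : kE + 8·u₁A + 8 ≤ 5·r₁`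
(= `NegB.hkE_apron_RA … 0`, FaceBandA2, at hp-8's `kE := kFF₂ … (E − 1) 0`).  Arithmetic: `lev ∈ [faceL 0 j − E, faceL 0 j + E]`, `faceL 0 j = 5r₀ + 10u₀(j+1) − 1`,
`E ≤ u₀`, `r₀ = 40·Kq·u₀`, `b0TA 0 = 10·Kq·u₀`.
builds on p205010 (kernel theorem, internal audit signed; external expert review pending) — nothing in this file uses p205010; NOTHING is claimed about the node
`SamePDropOfSkeletonNeg₁` (OPEN); integer arithmetic only.
Lane `prim-bschramm-*`, seat `prim-bschramm-p1` (gen 14); helper file (`--supports stmt-CriticalPhenomena-4575 --as helper`); slot-ledger ζ′ v1.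
* **`hfR_XA`**, **`hZfar_XA`**.
[cite: KozmaNitzan2024, §4 Lemma 12 (pp. 23–25)] [cite: MartineauTassion2017, §4.1]
-/

noncomputable section

open scoped Classical

namespace Summit.CriticalPhenomena.PercolationContinuityZ3.Theorems.Transplant

namespace PlanarSkeletonFrm

namespace NegB

open Literature.Probability.Percolation Literature.Probability.LatticeModels SimpleGraph
open Literature.Probability.Percolation.KozmaNitzan.Cells (oth sgOf sgOf_sign)
open SkelConc (Consts)
open Skelφ.StepI (DataN)
open TwoAxis.Para (modulus)
open Neg

namespace KS

section FloorsZ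

/-- **M3 x-face field `hfR`** at the (ζ′) tuple: the habitat `flo = 5r₀ + 10u₀j + 3 − lev ≤ −kF₀A`, `kF₀A ≤ fhi = 25r₀ − 2 − lev`, and transversally
`kF₁A ≤ 5r₁ − 7 − c 0 − |z 1 − cenS x 1|` (N2: the creep `c 0 ≤ r 1` of the staggered cells enters the transverse habitat). [cite: KozmaNitzan2024, §4 Lemma 12 (pp. 23–25)] -/
theorem hfR_XA (κ : Consts) {V : Type} [DecidableEq V] [Countable V] {G : SimpleGraph V} [G.LocallyFinite] (Φ : PlanarSkeletonFrm G) (t : V) (p : unitInterval) (D : Skelφ.StepI.DataNS V) (c : ℕ) (mk : ℕ) (g : ℕ) (f : ℕ) (P : PCells2T) (hP : P.toPCells2 = fcellsA κ Φ t p D g f) (x : Site 2) (du : MDir) (hd : du.1 = 0) (j : ℕ) (hj : j < P.K) (z : Site 2) {E : ℕ} {kE : ℤ}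
    (hlev1 : P.faceL 0 j - E ≤ P.lev du x z) (hlev2 : P.lev du x z ≤ P.faceL 0 j + E)
    (hz : |z 1 - P.cenS x 1| ≤ kE) (hEu : (E : ℤ) ≤ u₀A κ Φ t p D g f)
    (hkF0 : kF₀A κ Φ t p D c mk g f ≤ 8 * u₀A κ Φ t p D g f + 1) (hkF1 : kF₁A κ Φ t p D c mk g f ≤ 8 * u₁A κ Φ t p D g f + 1)
    (hs0 : 6 * (KS0.R'0 κ Φ t p D mk : ℤ) + 11 ≤ u₀A κ Φ t p D g f) (hkE8 : kE + 8 * u₁A κ Φ t p D g f + 8 + P.c 0 ≤ 5 * (P.r 1 : ℤ)) :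
    (5 * (P.r du.1 : ℤ) + 10 * (P.s du.1 : ℤ) * j + 3 - P.lev du x z) ≤ -((fun i : Fin 2 => if i = 0 then kF₀A κ Φ t p D c mk g f else kF₁A κ Φ t p D c mk g f) du.1) ∧ ((fun i : Fin 2 => if i = 0 then kF₀A κ Φ t p D c mk g f else kF₁A κ Φ t p D c mk g f) du.1) ≤ (25 * (P.r du.1 : ℤ) - 2 - P.lev du x z) ∧ ((fun i : Fin 2 => if i = 0 then kF₀A κ Φ t p D c mk g f else kF₁A κ Φ t p D c mk g f) (oth du.1)) ≤ (5 * (P.r (oth du.1) : ℤ) - 4 - (3 : ℤ) - P.c du.1 - |z (oth du.1) - P.cenS x (oth du.1)|) := by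
  rw [hd, show oth (0 : Fin 2) = 1 from rfl]
  simp only [if_true, show ((1 : Fin 2) = 0) = False from propext ⟨fun h => absurd h (by decide), False.elim⟩, if_false]
  obtain ⟨f1, f2⟩ := faceL_bounds κ Φ t p D g f P hP j hj
  have hR0 : (0 : ℤ) ≤ (KS0.R'0 κ Φ t p D mk : ℤ) := Nat.cast_nonneg _
  have hr : (P.r 0 : ℤ) = 40 * (Neg.Kq κ : ℤ) * u₀A κ Φ t p D g f := by rw [(cells_of_hP κ Φ t p D g f P hP).1 0]; exact (units_eqA κ Φ t p D g f).2.2.1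
  have hq : (1 : ℤ) ≤ Neg.Kq κ := by exact_mod_cast Neg.one_le_Kq κ
  have es : ((P.s 0 : ℕ) : ℤ) = u₀A κ Φ t p D g f := by rw [(cells_of_hP κ Φ t p D g f P hP).2.1 0]; rfl
  have hfl : P.faceL 0 j = 5 * (P.r 0 : ℤ) + 10 * u₀A κ Φ t p D g f * ((j : ℤ) + 1) - 1 := by
    unfold PCells2.faceL; rw [es]; push_cast; ring
  rw [es]
  rw [hfl] at hlev1 hlev2
  have hu : 1 ≤ u₀A κ Φ t p D g f := (units_eqA κ Φ t p D g f).2.2.2.2.1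
  have hQu : u₀A κ Φ t p D g f ≤ (Neg.Kq κ : ℤ) * u₀A κ Φ t p D g f := le_mul_of_one_le_left (by linarith) hq
  have hz' := (abs_nonneg _).trans hz
  refine ⟨by linarith, by linarith, by linarith⟩

/-- **M3 x-face field `hZfar`** at the (ζ′) tuple: `lev + kF₀A + 1 < 20r₀ − b0TA 0` (`lev ≤ 15r₀ − 1 + E`, `kF₀A ≤ 8u₀ + 1`, `b0TA 0 = 10·Kq·u₀`,
`5r₀ = 200·Kq·u₀`). [cite: KozmaNitzan2024, §4 Lemma 12 (pp. 23–25)] -/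
theorem hZfar_XA (κ : Consts) {V : Type} [DecidableEq V] [Countable V] {G : SimpleGraph V} [G.LocallyFinite] (Φ : PlanarSkeletonFrm G) (t : V) (p : unitInterval) (D : Skelφ.StepI.DataNS V) (c : ℕ) (mk : ℕ) (g : ℕ) (f : ℕ) (P : PCells2T) (hP : P.toPCells2 = fcellsA κ Φ t p D g f) (x : Site 2) (du : MDir) (hd : du.1 = 0) (j : ℕ) (hj : j < P.K) (z : Site 2) {E : ℕ}
    (hlev2 : P.lev du x z ≤ P.faceL 0 j + E) (hEu : (E : ℤ) ≤ u₀A κ Φ t p D g f)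
    (hkF0 : kF₀A κ Φ t p D c mk g f ≤ 8 * u₀A κ Φ t p D g f + 1) :
    P.lev du x z + ((fun i : Fin 2 => if i = 0 then kF₀A κ Φ t p D c mk g f else kF₁A κ Φ t p D c mk g f) du.1) + 1 < 20 * (P.r du.1 : ℤ) - ((NegB.BSlot.small κ Φ t p D g f du.1 : ℕ) : ℤ) := by
  rw [hd]
  simp only [if_true]
  obtain ⟨-, f2⟩ := faceL_bounds κ Φ t p D g f P hP j hj
  have hr : (P.r 0 : ℤ) = 40 * (Neg.Kq κ : ℤ) * u₀A κ Φ t p D g f := by rw [(cells_of_hP κ Φ t p D g f P hP).1 0]; exact (units_eqA κ Φ t p D g f).2.2.1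
  have hb : ((NegB.BSlot.small κ Φ t p D g f 0 : ℕ) : ℤ) = 30 * u₀A κ Φ t p D g f := by rw [(NegB.small_eq κ Φ t p D g f).1]; unfold u₀A; push_cast; ring
  have hq : (1 : ℤ) ≤ Neg.Kq κ := by exact_mod_cast Neg.one_le_Kq κ
  have hu : 1 ≤ u₀A κ Φ t p D g f := (units_eqA κ Φ t p D g f).2.2.2.2.1
  have hQu : u₀A κ Φ t p D g f ≤ (Neg.Kq κ : ℤ) * u₀A κ Φ t p D g f := le_mul_of_one_le_left (by linarith) hq
  rw [hb]
  linarith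

end FloorsZ

end KS

end NegB

end PlanarSkeletonFrm

end Summit.CriticalPhenomena.PercolationContinuityZ3.Theorems.Transplant

end
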